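import Summits.SmoothPoincare4.SmoothPoincare4.Theorems.CylinderEntropyCylinderRungTwoMinimalIsSlice
import Summits.SmoothPoincare4.SmoothPoincare4.Theorems.CylinderEntropyCylinderRungTwoAreaDissipation
import HarnessLib

/-!
# Route `CylinderEntropy`, crux `CylinderRungTwo` (stmt-SmoothPoincare4-7631), line `killing-flux`:
# STATIC IMMORTAL LEAVES ARE SLICES, AND THE LEAF IS `S⁴`
# (registered helper `helper_staticLeafIsSphere`, wave 3)

Let `N = S⁴ × ℝ ⊂ ℝ⁶` and let `IsCylinderMCF M F ν T` be a smooth mean curvature flow of embedded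
cross-sections `F t : M⁴ → N` (`t ≥ T`) of a closed connected `4`-manifold `M`, with unit normals
`ν t` tangent to `N` and velocity `∂F/∂t = -H ν` (`…KillingFluxDefs.lean`). If the flow is STATIC,
`F t = F T` for all `t ≥ T`, then `F T (M)` is a whole slice `S⁴ × {c} = range (sliceMap c)` and
`M ≃ₘ S⁴` — the recognition of immortal leaves is exact on the fixed points of the flow,
unconditionally.

Proof.
1. At the interior time `t₀ := T + 1` the curve `s ↦ F s x` agrees with the constant `F T x` on the
   neighbourhood `Ioi T` of `t₀`, so `deriv (s ↦ F s x) t₀ = 0` (`deriv_curve_eq_zero_of_static`).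
2. The flow equation `deriv (s ↦ F s x) t₀ = -H(t₀, x) ν(t₀, x)` (`IsCylinderMCF.deriv_slice_eq`)
   and `‖ν‖ = 1 ≠ 0` give `H(t₀, ·) ≡ 0` (`meanCurvature_eq_zero_of_static`).
3. Only slices are closed connected embedded minimal cross-sections of `N`, with `M ≃ₘ S⁴`
   (`range_eq_sliceMap_and_diffeo_of_meanCurvature_eq_zero`, `…MinimalIsSlice.lean`); finally
   `F t₀ = F T`.

Everything here is PROVED (no `sorry`, no new definitions, no named facts).

References: R. S. Hamilton, Comm. Anal. Geom. 1 (1993) 127–137, §4 (the slices `S⁴ × {c}` as the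
static solutions of the flow in `S⁴ × ℝ`).
-/

-- the prescribed namespace `Summit.SmoothPoincare4.SmoothPoincare4.…` repeats `SmoothPoincare4`
set_option linter.dupNamespace false

noncomputable section

open Set Filter
open scoped Manifold ContDiff Topology

namespace Summit.SmoothPoincare4.SmoothPoincare4.Cruxes.CylinderRungTwo.KillingFlux

open Literature.Geometry.Riemannian Literature.Geometry.Lorentzian
  Literature.Geometry.Lorentzian.PseudoRiemannianMetric

/-! ## A static flow has vanishing velocity and vanishing mean curvature -/

/-- **The point curves of a static family are critical at interior times.** If `F s = F T` for
all `s ≥ T`, then for `T < t₀` the curve `s ↦ F s x` is constant on the neighbourhood `Ioi T` of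
`t₀`, hence `deriv (s ↦ F s x) t₀ = 0`. [folklore] -/
theorem deriv_curve_eq_zero_of_static {M : Type} {F : ℝ → M → EuclideanSpace ℝ (Fin 6)} {T t₀ : ℝ}
    (hstat : ∀ t, T ≤ t → F t = F T) (ht₀ : T < t₀) (x : M) :
    deriv (fun s => F s x) t₀ = 0 := by
  have hev : (fun s => F s x) =ᶠ[𝓝 t₀] fun _ => F T x := by
    filter_upwards [Ioi_mem_nhds ht₀] with s hs
    exact congrFun (hstat s (le_of_lt hs)) x
  rw [hev.deriv_eq]
  exact deriv_const t₀ (F T x)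

/-- **A static cylinder flow is minimal at every interior time.** Along a smooth cylinder flow
`IsCylinderMCF M F ν T` with `F t = F T` for all `t ≥ T`, the mean curvature of `(F t₀, ν t₀)`
vanishes identically for every `t₀ > T`: the flow equation `∂ₜF = -H ν`
(`IsCylinderMCF.deriv_slice_eq`) has vanishing left-hand side
(`deriv_curve_eq_zero_of_static`), and `ν t₀ x ≠ 0` since `⟪ν, ν⟫ = 1`. [folklore] -/
theorem meanCurvature_eq_zero_of_static {M : Type} [TopologicalSpace M]
    [ChartedSpace (EuclideanSpace ℝ (Fin 4)) M] [IsManifold (𝓡 4) ∞ M]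
    {F ν : ℝ → M → EuclideanSpace ℝ (Fin 6)} {T t₀ : ℝ} (hF : IsCylinderMCF M F ν T)
    (hstat : ∀ t, T ≤ t → F t = F T) (ht₀ : T < t₀) (x : M) :
    (euclideanMetric (EuclideanSpace ℝ (Fin 6))).meanCurvature (F t₀)
      contMDiff_pullbackBilin_holds (hF.isSpacelikeImmersion t₀ (le_of_lt ht₀)) (ν t₀) x = 0 := by
  have h1 := hF.deriv_slice_eq (le_of_lt ht₀) x
  rw [deriv_curve_eq_zero_of_static hstat ht₀ x] at h1
  have hν : ν t₀ x ≠ 0 := by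
    intro h0
    -- `⟪ν, ν⟫ = 1`, read in `ℝ⁶` (the tangent spaces of `ℝ⁶` are `ℝ⁶` by definition)
    have h2 : inner ℝ (ν t₀ x) (ν t₀ x) = (1 : ℝ) := by
      have h := (hF.isUnitNormal t₀ (le_of_lt ht₀)).val_self x
      rw [euclideanMetric_apply] at h
      exact h
    rw [h0, inner_zero_left] at h2
    exact zero_ne_one h2
  exact neg_eq_zero.mp ((smul_eq_zero.mp h1.symm).resolve_right hν)

/-! ## Static immortal leaves are slices and diffeomorphic to `S⁴` -/

/-- **Registered helper `helper_staticLeafIsSphere` of line `killing-flux` (wave 3: static immortal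
leaves are recognised unconditionally).** If a smooth mean curvature flow of embedded
cross-sections `F t : M⁴ → N = S⁴ × ℝ` (`IsCylinderMCF M F ν T`) of a closed connected `4`-manifold
is static, `F t = F T` for all `t ≥ T`, then `F T (M)` is a whole slice
`S⁴ × {c} = range (sliceMap c)` and `M ≃ₘ S⁴`: at the interior time `t₀ = T + 1` the velocity
`-H ν` vanishes, so `H ≡ 0` (`meanCurvature_eq_zero_of_static`), and only slices are closed
connected embedded minimal cross-sections of `N`
(`range_eq_sliceMap_and_diffeo_of_meanCurvature_eq_zero`). [cite: Hamilton1993, §4] -/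
theorem helper_staticLeafIsSphere :
    ∀ (M : Type) [TopologicalSpace M] [T2Space M] [SecondCountableTopology M]
      [ChartedSpace (EuclideanSpace ℝ (Fin 4)) M] [IsManifold (𝓡 4) ∞ M] [CompactSpace M]
      [ConnectedSpace M] (F : ℝ → M → EuclideanSpace ℝ (Fin 6))
      (ν : ℝ → M → EuclideanSpace ℝ (Fin 6)) (T : ℝ),
      IsCylinderMCF M F ν T → (∀ t, T ≤ t → F t = F T) →
        (∃ c : ℝ, Set.range (F T) =
            Set.range (Literature.Geometry.Manifold.CylinderSlice.sliceMap c)) ∧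
          Nonempty (M ≃ₘ⟮𝓡 4, 𝓡 4⟯ Metric.sphere (0 : EuclideanSpace ℝ (Fin 5)) 1) := by
  intro M _ _ _ _ _ _ _ F ν T hF hstat
  letI : MeasurableSpace M := borel M
  haveI : BorelSpace M := ⟨rfl⟩
  -- the interior time `t₀ = T + 1`
  have ht₀ : T < T + 1 := lt_add_one T
  obtain ⟨c, -, hrange, hdiff⟩ := range_eq_sliceMap_and_diffeo_of_meanCurvature_eq_zero
    (hF.isSmoothEmbedding (T + 1) (le_of_lt ht₀)) (hF.isSpacelikeImmersion (T + 1) (le_of_lt ht₀))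
    (hF.mem_cyl (T + 1) (le_of_lt ht₀)) (hF.contMDiff_normal (T + 1) (le_of_lt ht₀))
    (hF.isUnitNormal (T + 1) (le_of_lt ht₀)) (hF.normal_tangent (T + 1) (le_of_lt ht₀))
    (meanCurvature_eq_zero_of_static hF hstat ht₀)
  rw [hstat (T + 1) (le_of_lt ht₀)] at hrange
  exact ⟨⟨c, hrange⟩, hdiff⟩

end Summit.SmoothPoincare4.SmoothPoincare4.Cruxes.CylinderRungTwo.KillingFlux

end
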